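import Summits.Ventures.HodgeRepro2.T5U11Unimodular
import Summits.Ventures.HodgeRepro2.T5CentreU11

/-!
# `U(1,1) = Z · SU(1,1)`: the Haar measure of `U(1,1)` as the image of the product measure

The multiplication map `φ : Circle × SU(1,1) → U(1,1)`, `(λ, h) ↦ (λ·1) h`, is a continuous
surjective homomorphism (kernel `{(1, 1), (-1, -1)}`) and proper (its fibres sit in
`Circle × (compact)`); hence (Mathlib's `isHaarMeasure_map`) it carries the product of Haar
measures on `Circle` and `SU(1,1)` to a Haar measure on `U(1,1)`, which is a positive multiple `c`
of any given Haar measure `μ_U` (uniqueness).  Consequently, for an integrable `F` on `U(1,1)`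
invariant under the centre, `∫ F ∂μ_U = c⁻¹ · μ_C(univ) · ∫_{SU(1,1)} F ∂μ_S` — the
«`∫_{U(1,1)} = (vol Z_j / 2) ∫_{SU(1,1)}`» bookkeeping of the support map's P3 cross-check, with
the constant `c` (`= 2` for the matching normalisations) left as the explicit scalar
`haarScalarFactor`.

Blind lane: Mathlib + own prefix only; no sorry; axioms ⊆ {propext, Classical.choice, Quot.sound}.
-/

namespace Summit.Ventures.HodgeRepro2.T5U11Product

open MeasureTheory MeasureTheory.Measure Topology Filter T5UnitaryBound T5U11Unimodular
  T5SU11Unimodular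
open Matrix hiding J
open scoped NNReal

/-- A point of the circle is a non-zero complex number. -/
lemma coe_ne_zero (lam : Circle) : (lam : ℂ) ≠ 0 := by
  intro h
  have := Circle.norm_coe lam
  rw [h, norm_zero] at this
  exact zero_ne_one this

/-- The scalar embedding `Circle →* U(1,1)`, `λ ↦ λ·1`. -/
noncomputable def scalarHom : Circle →* U11 where
  toFun lam := ⟨scalarUnit (lam : ℂ) (coe_ne_zero lam),
    scalarUnit_mem _ _ (by rw [Complex.normSq_eq_norm_sq, Circle.norm_coe, one_pow])⟩
  map_one' := by
    apply Subtype.ext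
    apply Units.ext
    simp
  map_mul' a b := by
    apply Subtype.ext
    apply Units.ext
    simp only [Subgroup.coe_mul, Units.val_mul, coe_scalarUnit, Circle.coe_mul]
    rw [smul_mul_smul_comm, Matrix.one_mul]

/-- The matrix of `scalarHom λ`. -/
@[simp] lemma coe_scalarHom (lam : Circle) :
    (((scalarHom lam : U11) : GL (Fin 2) ℂ) : Matrix (Fin 2) (Fin 2) ℂ) = (lam : ℂ) • 1 :=
  rfl

/-- `scalarHom` is continuous. -/
theorem continuous_scalarHom : Continuous scalarHom := by
  apply Continuous.subtype_mk
  rw [Units.continuous_iff]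
  constructor
  · exact (continuous_subtype_val.smul continuous_const)
  · exact ((continuous_subtype_val.inv₀ coe_ne_zero).smul continuous_const)

/-- `scalarHom λ` is central in `U(1,1)`. -/
theorem scalarHom_mem_center (lam : Circle) : scalarHom lam ∈ Subgroup.center U11 := by
  rw [Subgroup.mem_center_iff]
  intro x
  apply Subtype.ext
  show (x : GL (Fin 2) ℂ) * scalarUnit (lam : ℂ) (coe_ne_zero lam) =
    scalarUnit (lam : ℂ) (coe_ne_zero lam) * (x : GL (Fin 2) ℂ)
  exact Subgroup.mem_center_iff.mp (scalarUnit_mem_center _ _) (x : GL (Fin 2) ℂ)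

/-- The inclusion `SU(1,1) →* U(1,1)`. -/
noncomputable def incl : SU11 →* U11 :=
  (SpecialLinearGroup.toGL.comp SU11.subtype).codRestrict U11 fun h =>
    (mem_U11_iff _).mpr ((mem_SU11_iff (h : SpecialLinearGroup (Fin 2) ℂ)).mp h.2)

/-- The matrix of `incl h`. -/
@[simp] lemma coe_incl (h : SU11) :
    (((incl h : U11) : GL (Fin 2) ℂ) : Matrix (Fin 2) (Fin 2) ℂ) =
      ((h : SpecialLinearGroup (Fin 2) ℂ) : Matrix (Fin 2) (Fin 2) ℂ) :=
  rfl

/-- `incl` is continuous. -/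
theorem continuous_incl : Continuous incl :=
  (SpecialLinearGroup.continuous_toGL.comp continuous_subtype_val).subtype_mk _

/-- `incl` is injective. -/
theorem incl_injective : Function.Injective incl := by
  intro a b hab
  apply Subtype.ext
  apply Subtype.ext
  have := congr_arg (fun g : U11 => ((g : GL (Fin 2) ℂ) : Matrix (Fin 2) (Fin 2) ℂ)) hab
  simpa using this

/-- The range of `incl` is the determinant-one part of `U(1,1)`. -/
theorem range_incl :
    Set.range incl = {g : U11 | ((g : GL (Fin 2) ℂ) : Matrix (Fin 2) (Fin 2) ℂ).det = 1} := by
  ext g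
  constructor
  · rintro ⟨h, rfl⟩
    simp [Matrix.SpecialLinearGroup.det_coe]
  · intro hg
    refine ⟨⟨⟨((g : GL (Fin 2) ℂ) : Matrix (Fin 2) (Fin 2) ℂ), hg⟩, ?_⟩, ?_⟩
    · exact (mem_SU11_iff _).mpr ((mem_U11_iff _).mp g.2)
    · apply Subtype.ext
      apply Units.ext
      rfl

/-- `incl` is a closed embedding (`SU(1,1)` is closed in `U(1,1)`). -/
theorem isClosedEmbedding_incl : IsClosedEmbedding incl := by
  refine ⟨⟨?_, incl_injective⟩, ?_⟩
  · refine IsInducing.of_comp continuous_incl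
      (Units.continuous_val.comp continuous_subtype_val :
        Continuous fun g : U11 => ((g : GL (Fin 2) ℂ) : Matrix (Fin 2) (Fin 2) ℂ)) ?_
    exact SpecialLinearGroup.isClosedEmbedding_val.isInducing.comp IsInducing.subtypeVal
  · rw [range_incl]
    exact isClosed_singleton.preimage
      ((Units.continuous_val.comp continuous_subtype_val).matrix_det)

/-- The multiplication map `φ : Circle × SU(1,1) →* U(1,1)`, `(λ, h) ↦ (λ·1) h`. -/
noncomputable def mulHom : Circle × SU11 →* U11 where
  toFun p := scalarHom p.1 * incl p.2
  map_one' := by simp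
  map_mul' p q := by
    simp only [Prod.fst_mul, Prod.snd_mul, map_mul]
    have hc := Subgroup.mem_center_iff.mp (scalarHom_mem_center q.1) (incl p.2)
    calc scalarHom p.1 * scalarHom q.1 * (incl p.2 * incl q.2)
        = scalarHom p.1 * (scalarHom q.1 * incl p.2) * incl q.2 := by simp only [mul_assoc]
      _ = scalarHom p.1 * (incl p.2 * scalarHom q.1) * incl q.2 := by rw [← hc]
      _ = scalarHom p.1 * incl p.2 * (scalarHom q.1 * incl q.2) := by simp only [mul_assoc]

/-- `mulHom (λ, h) = scalarHom λ * incl h`. -/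
lemma mulHom_apply (p : Circle × SU11) : mulHom p = scalarHom p.1 * incl p.2 := rfl

/-- The matrix of `mulHom (λ, h)` is `λ • h`. -/
lemma coe_mulHom (p : Circle × SU11) :
    (((mulHom p : U11) : GL (Fin 2) ℂ) : Matrix (Fin 2) (Fin 2) ℂ) =
      (p.1 : ℂ) • ((p.2 : SpecialLinearGroup (Fin 2) ℂ) : Matrix (Fin 2) (Fin 2) ℂ) := by
  rw [mulHom_apply, Subgroup.coe_mul, Units.val_mul, coe_scalarHom, coe_incl, smul_mul_assoc,
    Matrix.one_mul]

/-- `mulHom` is continuous. -/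
theorem continuous_mulHom : Continuous mulHom :=
  (continuous_scalarHom.comp continuous_fst).mul (continuous_incl.comp continuous_snd)

/-- **`mulHom` is surjective**: `U(1,1) = Z · SU(1,1)` (`T5CentreU11.exists_smul_det_one`). -/
theorem mulHom_surjective : Function.Surjective mulHom := by
  intro g
  obtain ⟨z, h, hz, hh, hdet, hg⟩ := T5CentreU11.exists_smul_det_one ((mem_U11_iff _).mp g.2)
  refine ⟨(⟨z, mem_sphere_zero_iff_norm.mpr hz⟩, ⟨⟨h, hdet⟩, (mem_SU11_iff _).mpr hh⟩), ?_⟩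
  apply Subtype.ext
  apply Units.ext
  rw [coe_mulHom]
  exact hg.symm

/-- **`mulHom` is proper**: the preimage of a compact `K ⊆ U(1,1)` lies in
`Circle × incl⁻¹ (Z⁻¹ K)`, a compact set. -/
theorem tendsto_cocompact_mulHom : Tendsto mulHom (cocompact (Circle × SU11)) (cocompact U11) := by
  rw [Filter.hasBasis_cocompact.tendsto_right_iff]
  intro K hK
  rw [Filter.eventually_iff, Filter.mem_cocompact]
  -- the compact set `C = {(λ·1)⁻¹ g : λ ∈ Circle, g ∈ K}`
  set C : Set U11 := (fun p : Circle × U11 => (scalarHom p.1)⁻¹ * p.2) '' (Set.univ ×ˢ K) with hC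
  have hCc : IsCompact C :=
    (isCompact_univ.prod hK).image
      (((continuous_scalarHom.comp continuous_fst).inv).mul continuous_snd)
  refine ⟨Set.univ ×ˢ (incl ⁻¹' C), isCompact_univ.prod (isClosedEmbedding_incl.isCompact_preimage hCc), ?_⟩
  intro p hp
  simp only [Set.mem_compl_iff, Set.mem_prod, Set.mem_univ, true_and, Set.mem_preimage] at hp ⊢
  intro hpK
  apply hp
  refine ⟨(p.1, mulHom p), ⟨Set.mem_univ _, hpK⟩, ?_⟩
  show (scalarHom p.1)⁻¹ * mulHom p = incl p.2
  rw [mulHom_apply, inv_mul_cancel_left]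

section haar

variable [MeasurableSpace Circle] [BorelSpace Circle] [MeasurableSpace SU11] [BorelSpace SU11]
  [MeasurableSpace U11] [BorelSpace U11]

/-- The image of a product of Haar measures under `mulHom` is a Haar measure on `U(1,1)`. -/
instance isHaarMeasure_map_mulHom (μC : Measure Circle) [IsHaarMeasure μC] (μS : Measure SU11)
    [IsHaarMeasure μS] : IsHaarMeasure (map mulHom (μC.prod μS)) :=
  isHaarMeasure_map (μC.prod μS) mulHom continuous_mulHom mulHom_surjective tendsto_cocompact_mulHom

/-- **The product formula for the Haar measure of `U(1,1)`**: for Haar measures `μC`, `μS`, `μU` on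
`Circle`, `SU(1,1)`, `U(1,1)`, `map mulHom (μC.prod μS) = c • μU` with `c = haarScalarFactor _ _`
(Haar uniqueness on the second countable `U(1,1)`). -/
theorem map_mulHom_prod_eq_smul (μC : Measure Circle) [IsHaarMeasure μC] (μS : Measure SU11)
    [IsHaarMeasure μS] (μU : Measure U11) [IsHaarMeasure μU] :
    map mulHom (μC.prod μS) = haarScalarFactor (map mulHom (μC.prod μS)) μU • μU :=
  isMulLeftInvariant_eq_smul (map mulHom (μC.prod μS)) μU

/-- The scalar of the product formula is positive. -/
theorem haarScalarFactor_pos (μC : Measure Circle) [IsHaarMeasure μC] (μS : Measure SU11)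
    [IsHaarMeasure μS] (μU : Measure U11) [IsHaarMeasure μU] :
    0 < haarScalarFactor (map mulHom (μC.prod μS)) μU :=
  haarScalarFactor_pos_of_isHaarMeasure _ _

/-- **The integral form**: for an integrable `F` on `U(1,1)` invariant under the scalar circle,
`c · ∫ F ∂μU = μC(univ) · ∫ F (incl h) ∂μS(h)` with `c = haarScalarFactor (map mulHom (μC.prod μS)) μU`
— the «`∫_{U(1,1)} = (vol Z_j / 2) ∫_{SU(1,1)}`» bookkeeping (the normalisation constant is `c`). -/
theorem integral_eq_of_scalar_invariant (μC : Measure Circle) [IsHaarMeasure μC]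
    (μS : Measure SU11) [IsHaarMeasure μS] (μU : Measure U11) [IsHaarMeasure μU]
    {E : Type*} [NormedAddCommGroup E] [NormedSpace ℝ E] [CompleteSpace E] (F : U11 → E)
    (hF : Integrable F μU) (hinv : ∀ (lam : Circle) (g : U11), F (scalarHom lam * g) = F g) :
    (haarScalarFactor (map mulHom (μC.prod μS)) μU : ℝ) • ∫ g, F g ∂μU =
      (μC Set.univ).toReal • ∫ h, F (incl h) ∂μS := by
  set c := haarScalarFactor (map mulHom (μC.prod μS)) μU with hc
  have hmap : map mulHom (μC.prod μS) = c • μU := map_mulHom_prod_eq_smul μC μS μU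
  have hmeas : Measurable mulHom := continuous_mulHom.measurable
  have hint : Integrable F (map mulHom (μC.prod μS)) := by
    rw [hmap]
    exact hF.smul_measure ENNReal.coe_ne_top
  have hint' : Integrable (F ∘ mulHom) (μC.prod μS) :=
    (integrable_map_measure hint.aestronglyMeasurable hmeas.aemeasurable).mp hint
  have h1 : ∫ g, F g ∂(map mulHom (μC.prod μS)) = (c : ℝ) • ∫ g, F g ∂μU := by
    rw [hmap, integral_smul_nnreal_measure, NNReal.smul_def]
  have h2 : ∫ g, F g ∂(map mulHom (μC.prod μS)) = ∫ p, F (mulHom p) ∂(μC.prod μS) :=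
    integral_map hmeas.aemeasurable hint.aestronglyMeasurable
  have h3 : ∫ p, F (mulHom p) ∂(μC.prod μS) = ∫ lam, ∫ h, F (mulHom (lam, h)) ∂μS ∂μC :=
    integral_prod _ hint'
  have h4 : ∀ lam : Circle, ∫ h, F (mulHom (lam, h)) ∂μS = ∫ h, F (incl h) ∂μS := by
    intro lam
    congr 1
    ext h
    rw [mulHom_apply, hinv]
  rw [← h1, h2, h3]
  simp_rw [h4]
  rw [integral_const, measureReal_def]

end haar

end Summit.Ventures.HodgeRepro2.T5U11Product
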